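import Summits.BirchSwinnertonDyer.BirchSwinnertonDyer.Theorems.ByReductionTypeAtTwoOrdKatoHalfAtTwoIsoConjATwoOfNarrowRankCertificate
import Literature.NumberTheory.IwasawaTheory.CyclotomicTwoTotallyRamifiedIndexOne
import HarnessLib

/-!
# Route `ByReductionTypeAtTwo`, crux `OrdKatoHalfAtTwoIso` (stmt-BirchSwinnertonDyer-19573), the `0 < Δ` cell: Coates–Sujatha's (A) at `2` from the
# `n = 1` RUNG of the narrow rank certificate of the cubic point field — `rank₂ Cl⁺(ℚ(P)_2) = rank₂ Cl⁺(ℚ(P)_1)` with the CONCRETE MODELS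
# `ℚ(P)_1 ≅ ℚ(P)(√2)` and `ℚ(P)_2 ≅ ℚ(P)(√(2+√2))`

`--supports stmt-BirchSwinnertonDyer-19573` file of the width seat `cruxlead-stmt-BirchSwinnertonDyer-19573-w2` GEN 10 (cell `bsd-2adic`). THEOREMS ONLY
(no definition, no named fact, no `sorry`). Closes nothing: Q⁺, G11⁺ and the crux remain OPEN; no certificate is asserted for any curve here; BSD is not
proved by any of this.

WHAT. GEN 9's doors (`…ConjATwoOfNarrowRankCertificate`, §4) read the narrow rank certificate of NARROW FUKUDA at `n₀ = n = 0`: Fukuda index `0` and ONE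
equality `rank₂ Cl⁺(ℚ(P)(√2)) = rank₂ Cl⁺(ℚ(P))`.  When the narrow `2`-rank GROWS between `ℚ(P)` and `ℚ(P)(√2)` that certificate fails and Fukuda's
Theorem 1 (2) must be read at the next pair of layers `(1, 2)` — with `ℚ(P)_2 = ℚ(P)·ℚ(ζ₁₆)⁺ = ℚ(P)(√(2+√2))` of degree `12`.  This file wires the
Literature theorem `NarrowFukuda.narrowMu_of_index_zero_of_layerTwo_model` (this seat, `NarrowFukudaCertificateLayerTwoModel`: for an odd-degree `F`,
Fukuda index `0`, a model `L₁/F` of degree `2` with `θ₁² = 2` and a model `L₂/F` of degree `4` with `θ₂⁴ − 4θ₂² + 2 = 0`,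
`[Cl⁺(L₂) : Cl⁺(L₂)²] = [Cl⁺(L₁) : Cl⁺(L₁)²]` ⟹ (a) `μ₂ = 0` ∧ (b) bounded narrow defect) into GEN 8's Kida-lite road
(`NarrowMu.conjA_two_of_narrowMu_pointField`, `NarrowMu.conjA_two_cubicModel_of_narrowMu`).

* §1 **`conjA_two_of_narrowRank_layerTwo_model_pointField`** — (A) at `(W, 2)` (`∃ γ D` form, every cyclotomic `κ` of `ℚ`) for `W/ℚ` elliptic and
  `P ∈ W[2] ∖ 0` with `[ℚ(P) : ℚ]` odd, from Fukuda index `0` for `F = ℚ(P)` and ONE equality `rank₂ Cl⁺(L₂) = rank₂ Cl⁺(L₁)` of the models; ANY sign of `Δ`.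
* §2 **`conjA_two_cubicModel_of_narrowRank_layerTwo_model`** — the CUBIC-MODEL door in the census currency of C1″/C4″/k4 (`y² = x³ + px² + qx + r`,
  irreducible, `β` a root): Fukuda index `0` for `ℚ(β)` (tree criteria `forall_totallyRamifiedFrom_zero_of_not_dvd_discr` /
  `totallyRamifiedFrom_zero_of_evenIndexCertificate`) + models `L₁ ≅ ℚ(β,√2)` (degree `2` over `ℚ(β)`), `L₂ ≅ ℚ(β,√(2+√2))` (degree `4` over `ℚ(β)`) with
  `[Cl⁺(L₂) : Cl⁺(L₂)²] = [Cl⁺(L₁) : Cl⁺(L₁)²]` ⟹ (A)₂ for `⟨0, p, 0, q, r⟩` at every cyclotomic `κ` — ONE equality of narrow `2`-ranks of two explicit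
  fields of degrees `6` and `12` (the `k_1`, `k_2` rows of eng-2's `greenberg2.gp` `bnfnarrow` tables).
* §3 **NO RAMIFICATION HYPOTHESIS.**  A cubic field has Fukuda index `≤ 1` for EVERY cyclotomic `ℤ₂`-extension (this seat's
  `CyclotomicTwoTotallyRamifiedIndexOne`: `e(w|2) ≤ 3 < 4`, and `4 ∤ e(w|2)` ⟹ `w` ramifies in `K_2 ∋ √(2+√2)` ⟹ index `≤ 1`), so at the rung `n = 1` the
  certificate is the ONE equality and nothing else: **`conjA_two_of_narrowRank_layerTwo_eq_pointField`** (`[ℚ(P):ℚ] = 3`),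
  ★ **`conjA_two_cubicModel_of_narrowRank_layerTwo_eq`** — (A)₂ for `y² = x³ + px² + qx + r` (irreducible, `β` a root) from
  `[Cl⁺(L₂) : Cl⁺(L₂)²] = [Cl⁺(L₁) : Cl⁺(L₁)²]` for models `L₁ ≅ ℚ(β,√2)`, `L₂ ≅ ℚ(β,√(2+√2))`, NO OTHER HYPOTHESIS — and the Q⁺ ROAD
  ★ **`fineSelmerConjATwoOrdPosDisc_of_narrowRank_layer_two_eq_layer_one`**: if at every curve of the cell SOME `P ∈ W[2] ∖ 0` has
  `rank₂ Cl⁺(ℚ(P)_2) = rank₂ Cl⁺(ℚ(P)_1)` along every cyclotomic `ℤ₂`-extension of `ℚ(P)` (abstract layers; one finite datum per curve: the narrow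
  `2`-ranks of two fields of degrees `6` and `12`), then `FineSelmerConjATwoOrdPosDisc`.  (GEN 9's Q⁺ road needs the index `n₀` and a bound `B` as data;
  here both are discharged: `n₀ = 1` by the cubic index theorem, `B` by transport along unit twists, `index_layer_eq_of_isCyclotomic`.)

Honest scope: a property of the number field `ℚ(P)` is consumed, nothing is asserted about any field or curve; if the narrow `2`-rank grows again between
layers `1` and `2` this rung fails too (next pair `(2, 3)`, degree `24`), which does not refute narrow `μ₂ = 0`.

References: [Fukuda1994] Thm. 1 (2), p. 264; [Washington1997] §13.1 (`ℚ_2 = ℚ(ζ₁₆)⁺`); [Kida1982JFields] (μ-part; shape); [CoatesSujatha2005] Conj. A,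
Thm. 3.4; [Lim2017FineSelmer] §3 Thm. 3.5 / Lemma 3.2; [GreenbergLNM1716] p. 122, Conj. 1.11; tree p740352 (GEN 9), p734566 (GEN 8).
-/

set_option autoImplicit false
-- sibling precedent (`…ConjATwoOfNarrowRankCertificate.lean`): the directory name repeats the summit name
set_option linter.dupNamespace false

noncomputable section

open scoped Classical NumberField IntermediateField Polynomial

namespace Summit.BirchSwinnertonDyer.BirchSwinnertonDyer.Theorems.SteinbergFibreAtTwo.NarrowRankCert

open WeierstrassCurve NumberField IsDedekindDomain Field Polynomial
open Literature.NumberTheory.EllipticCurves Literature.NumberTheory.EllipticCurves.ZpExtension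
  Literature.NumberTheory.GaloisRepresentations Literature.NumberTheory.IwasawaTheory Literature.NumberTheory.NumberFields
  Literature.NumberTheory.EllipticCurves.Rank1Residual
open Summit.BirchSwinnertonDyer.BirchSwinnertonDyer.Theorems.AlignedTransportAtTwoTorsionPointField
open Summit.BirchSwinnertonDyer.BirchSwinnertonDyer.Theorems.SteinbergFibreAtTwo
open Summit.BirchSwinnertonDyer.BirchSwinnertonDyer.Theses.ByReductionTypeAtTwo

/-! ## §1 Statement (A) at `(W, 2)` from the layer-`1/2` narrow rank equality of an odd-degree point field — ANY sign of `Δ` -/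

section PointField

variable (W : WeierstrassCurve ℚ) [W.IsElliptic]

/-- **(A) at `(W, 2)` from ONE equality of narrow `2`-ranks at the layers `1` and `2` of the point field** (`W/ℚ` elliptic, `P ∈ W[2] ∖ 0`,
`[ℚ(P) : ℚ]` odd): if every cyclotomic `ℤ₂`-extension of `F = ℚ(P) = ℚ̄^{Stab P}` has Fukuda index `0` (tree criteria:
`forall_totallyRamifiedFrom_zero_of_not_dvd_discr` for `2 ∤ d_F`, `totallyRamifiedFrom_zero_of_evenIndexCertificate`), `L₁/F` is a quadratic extension
with a square root `θ₁` of `2` (a model of `F_1 = F(√2)`), `L₂/F` an extension of degree `4` with a root `θ₂` of `X⁴ − 4X² + 2` (a model of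
`F_2 = F(√(2+√2))`), and `[Cl⁺(L₂) : Cl⁺(L₂)²] = [Cl⁺(L₁) : Cl⁺(L₁)²]`, then for every cyclotomic `ℤ₂`-extension `κ` of `ℚ` some `FineSelmerDualData` of
`W` has `X` finitely generated over `ℤ₂`.  `NarrowFukuda.narrowMu_of_index_zero_of_layerTwo_model` + GEN 8's `NarrowMu.conjA_two_of_narrowMu_pointField`.
[cite: Fukuda1994, Thm. 1 (2), p. 264] [cite: Washington1997, §13.1] [cite: CoatesSujatha2005, Conj. A and Thm. 3.4] -/
theorem conjA_two_of_narrowRank_layerTwo_model_pointField {P : geomTorsion W 2} (hP : P ≠ 0)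
    (hodd : Odd (Module.finrank ℚ ↥(IntermediateField.fixedField (MulAction.stabilizer (absoluteGaloisGroup ℚ) P))))
    (h0 : ∀ κP : ZpExtension ↥(IntermediateField.fixedField (MulAction.stabilizer (absoluteGaloisGroup ℚ) P)) 2,
      κP.IsCyclotomic → TotallyRamifiedFrom κP 0)
    [NumberField ↥(IntermediateField.fixedField (MulAction.stabilizer (absoluteGaloisGroup ℚ) P))]
    (L₁ : Type) [Field L₁] [NumberField L₁] [Algebra ↥(IntermediateField.fixedField (MulAction.stabilizer (absoluteGaloisGroup ℚ) P)) L₁]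
    (hL₁ : Module.finrank ↥(IntermediateField.fixedField (MulAction.stabilizer (absoluteGaloisGroup ℚ) P)) L₁ = 2) (θ₁ : L₁) (hθ₁ : θ₁ ^ 2 = 2)
    (L₂ : Type) [Field L₂] [NumberField L₂] [Algebra ↥(IntermediateField.fixedField (MulAction.stabilizer (absoluteGaloisGroup ℚ) P)) L₂]
    (hL₂ : Module.finrank ↥(IntermediateField.fixedField (MulAction.stabilizer (absoluteGaloisGroup ℚ) P)) L₂ = 4) (θ₂ : L₂)
    (hθ₂ : θ₂ ^ 4 - 4 * θ₂ ^ 2 + 2 = 0)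
    (hr : (powMonoidHom (α := NarrowClassGroup L₂) 2).range.index = (powMonoidHom (α := NarrowClassGroup L₁) 2).range.index)
    (κ : ZpExtension ℚ 2) (hκ : κ.IsCyclotomic) :
    ∃ (γ : absoluteGaloisGroup ℚ) (Dd : W.FineSelmerDualData κ γ),
      Module.Finite ℤ_[2] (RestrictScalars ℤ_[2] (IwasawaAlgebra 2) Dd.X) := by
  obtain ⟨hμ, hδ⟩ := NarrowFukuda.narrowMu_of_index_zero_of_layerTwo_model
    (↥(IntermediateField.fixedField (MulAction.stabilizer (absoluteGaloisGroup ℚ) P))) hodd h0 L₁ hL₁ θ₁ hθ₁ L₂ hL₂ θ₂ hθ₂ hr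
  exact NarrowMu.conjA_two_of_narrowMu_pointField W hP hodd hμ _ hδ κ hκ

end PointField

/-! ## §2 The cubic-model door at the rung `n = 1` (census currency of C1″ / C4″ / k4: `y² = x³ + px² + qx + r`, `β` a root) -/

/-- **(A) at `2` for `y² = x³ + px² + qx + r` (irreducible, `β` a root) from ONE equality of narrow `2`-ranks `rank₂ Cl⁺(ℚ(β)(√(2+√2))) = rank₂ Cl⁺(ℚ(β)(√2))`**
— the `n = 1` rung in the census currency: Fukuda index `0` for every cyclotomic `ℤ₂`-extension of `ℚ(β)` (tree criteria), a model `L₁ ⊇ ℚ(β)` of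
`ℚ(β, √2)` (`[L₁ : ℚ(β)] = 2`, `θ₁² = 2`), a model `L₂ ⊇ ℚ(β)` of `ℚ(β)_2 = ℚ(β, √(2+√2))` (`[L₂ : ℚ(β)] = 4`, `θ₂⁴ − 4θ₂² + 2 = 0`) with
`[Cl⁺(L₂) : Cl⁺(L₂)²] = [Cl⁺(L₁) : Cl⁺(L₁)²]` ⟹ (A)₂ for `⟨0, p, 0, q, r⟩` at every cyclotomic `κ`.  The rung to use when `rank₂ Cl⁺(ℚ(β,√2)) > rank₂ Cl⁺(ℚ(β))`
(GEN 9's `conjA_two_cubicModel_of_narrowRank_sqrtTwo_model` is the rung `n = 0`). Nothing is asserted about any curve.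
[cite: Fukuda1994, Thm. 1 (2), p. 264] [cite: Washington1997, §13.1] [cite: CoatesSujatha2005, Conj. A and Thm. 3.4] -/
theorem conjA_two_cubicModel_of_narrowRank_layerTwo_model (p q r : ℤ)
    [((⟨0, (p : ℚ), 0, (q : ℚ), (r : ℚ)⟩ : WeierstrassCurve ℚ)).IsElliptic]
    (hirr : Irreducible (Cubic.toPoly ⟨1, (p : ℚ), q, r⟩))
    {β : AlgebraicClosure ℚ} (hβ : aeval β (Cubic.toPoly ⟨1, (p : ℚ), q, r⟩) = 0)
    (h0 : ∀ κP : ZpExtension ↥(IntermediateField.adjoin ℚ ({β} : Set (AlgebraicClosure ℚ))) 2, κP.IsCyclotomic → TotallyRamifiedFrom κP 0)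
    [NumberField ↥(IntermediateField.adjoin ℚ ({β} : Set (AlgebraicClosure ℚ)))]
    (L₁ : Type) [Field L₁] [NumberField L₁] [Algebra ↥(IntermediateField.adjoin ℚ ({β} : Set (AlgebraicClosure ℚ))) L₁]
    (hL₁ : Module.finrank ↥(IntermediateField.adjoin ℚ ({β} : Set (AlgebraicClosure ℚ))) L₁ = 2) (θ₁ : L₁) (hθ₁ : θ₁ ^ 2 = 2)
    (L₂ : Type) [Field L₂] [NumberField L₂] [Algebra ↥(IntermediateField.adjoin ℚ ({β} : Set (AlgebraicClosure ℚ))) L₂]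
    (hL₂ : Module.finrank ↥(IntermediateField.adjoin ℚ ({β} : Set (AlgebraicClosure ℚ))) L₂ = 4) (θ₂ : L₂)
    (hθ₂ : θ₂ ^ 4 - 4 * θ₂ ^ 2 + 2 = 0)
    (hr : (powMonoidHom (α := NarrowClassGroup L₂) 2).range.index = (powMonoidHom (α := NarrowClassGroup L₁) 2).range.index)
    (κ : ZpExtension ℚ 2) (hκ : κ.IsCyclotomic) :
    ∃ (γ : absoluteGaloisGroup ℚ) (Dd : ((⟨0, (p : ℚ), 0, (q : ℚ), (r : ℚ)⟩ : WeierstrassCurve ℚ)).FineSelmerDualData κ γ),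
      Module.Finite ℤ_[2] (RestrictScalars ℤ_[2] (IwasawaAlgebra 2) Dd.X) := by
  -- `ℚ(β)` is a cubic number field
  have hmonic : (Cubic.toPoly ⟨1, (p : ℚ), q, r⟩).Monic := Cubic.monic_of_a_eq_one rfl
  have hβint : IsIntegral ℚ β := ⟨_, hmonic, by rwa [← aeval_def]⟩
  have h3 : Module.finrank ℚ ↥(IntermediateField.adjoin ℚ ({β} : Set (AlgebraicClosure ℚ))) = 3 := by
    rw [IntermediateField.adjoin.finrank hβint, ← minpoly.eq_of_irreducible_of_monic hirr hβ hmonic]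
    exact Cubic.natDegree_of_a_ne_zero' one_ne_zero
  have hodd : Odd (Module.finrank ℚ ↥(IntermediateField.adjoin ℚ ({β} : Set (AlgebraicClosure ℚ)))) := by
    rw [h3]; decide
  obtain ⟨hμ, hδ⟩ := NarrowFukuda.narrowMu_of_index_zero_of_layerTwo_model
    (↥(IntermediateField.adjoin ℚ ({β} : Set (AlgebraicClosure ℚ)))) hodd h0 L₁ hL₁ θ₁ hθ₁ L₂ hL₂ θ₂ hθ₂ hr
  exact NarrowMu.conjA_two_cubicModel_of_narrowMu p q r hirr hβ hμ _ hδ κ hκ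

/-- **The fully explicit cubic-model door at the rung `n = 1` for `2 ∤ disc`**: for `y² = x³ + px² + qx + r` (irreducible, `β` a root) whose cubic field
`ℚ(β)` has ODD discriminant (so `2` is unramified and Fukuda's index is `0` for every cyclotomic `ℤ₂`-extension,
`forall_totallyRamifiedFrom_zero_of_not_dvd_discr`), models `L₁ ≅ ℚ(β,√2)`, `L₂ ≅ ℚ(β,√(2+√2))` with `[Cl⁺(L₂) : Cl⁺(L₂)²] = [Cl⁺(L₁) : Cl⁺(L₁)²]` give (A)₂ —
ZERO further hypotheses. [cite: Fukuda1994, Thm. 1 (2), p. 264] [cite: Washington1997, §13.1 and Prop. 13.2] [cite: CoatesSujatha2005, Conj. A and Thm. 3.4] -/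
theorem conjA_two_cubicModel_of_not_dvd_discr_of_narrowRank_layerTwo_model (p q r : ℤ)
    [((⟨0, (p : ℚ), 0, (q : ℚ), (r : ℚ)⟩ : WeierstrassCurve ℚ)).IsElliptic]
    (hirr : Irreducible (Cubic.toPoly ⟨1, (p : ℚ), q, r⟩))
    {β : AlgebraicClosure ℚ} (hβ : aeval β (Cubic.toPoly ⟨1, (p : ℚ), q, r⟩) = 0)
    [NumberField ↥(IntermediateField.adjoin ℚ ({β} : Set (AlgebraicClosure ℚ)))]
    (hd : ¬ (2 : ℤ) ∣ NumberField.discr ↥(IntermediateField.adjoin ℚ ({β} : Set (AlgebraicClosure ℚ))))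
    (L₁ : Type) [Field L₁] [NumberField L₁] [Algebra ↥(IntermediateField.adjoin ℚ ({β} : Set (AlgebraicClosure ℚ))) L₁]
    (hL₁ : Module.finrank ↥(IntermediateField.adjoin ℚ ({β} : Set (AlgebraicClosure ℚ))) L₁ = 2) (θ₁ : L₁) (hθ₁ : θ₁ ^ 2 = 2)
    (L₂ : Type) [Field L₂] [NumberField L₂] [Algebra ↥(IntermediateField.adjoin ℚ ({β} : Set (AlgebraicClosure ℚ))) L₂]
    (hL₂ : Module.finrank ↥(IntermediateField.adjoin ℚ ({β} : Set (AlgebraicClosure ℚ))) L₂ = 4) (θ₂ : L₂)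
    (hθ₂ : θ₂ ^ 4 - 4 * θ₂ ^ 2 + 2 = 0)
    (hr : (powMonoidHom (α := NarrowClassGroup L₂) 2).range.index = (powMonoidHom (α := NarrowClassGroup L₁) 2).range.index)
    (κ : ZpExtension ℚ 2) (hκ : κ.IsCyclotomic) :
    ∃ (γ : absoluteGaloisGroup ℚ) (Dd : ((⟨0, (p : ℚ), 0, (q : ℚ), (r : ℚ)⟩ : WeierstrassCurve ℚ)).FineSelmerDualData κ γ),
      Module.Finite ℤ_[2] (RestrictScalars ℤ_[2] (IwasawaAlgebra 2) Dd.X) := by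
  have hmonic : (Cubic.toPoly ⟨1, (p : ℚ), q, r⟩).Monic := Cubic.monic_of_a_eq_one rfl
  have hβint : IsIntegral ℚ β := ⟨_, hmonic, by rwa [← aeval_def]⟩
  have h3 : Module.finrank ℚ ↥(IntermediateField.adjoin ℚ ({β} : Set (AlgebraicClosure ℚ))) = 3 := by
    rw [IntermediateField.adjoin.finrank hβint, ← minpoly.eq_of_irreducible_of_monic hirr hβ hmonic]
    exact Cubic.natDegree_of_a_ne_zero' one_ne_zero
  have hK : ¬ 2 ∣ Module.finrank ℚ ↥(IntermediateField.adjoin ℚ ({β} : Set (AlgebraicClosure ℚ))) := by rw [h3]; decide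
  exact conjA_two_cubicModel_of_narrowRank_layerTwo_model p q r hirr hβ
    (forall_totallyRamifiedFrom_zero_of_not_dvd_discr hK hd) L₁ hL₁ θ₁ hθ₁ L₂ hL₂ θ₂ hθ₂ hr κ hκ

/-! ## §3 The rung `n = 1` with NO ramification hypothesis (cubic fields have Fukuda index `≤ 1`) and the Q⁺ road -/

section NoHypothesis

variable (W : WeierstrassCurve ℚ) [W.IsElliptic]

/-- **(A) at `(W, 2)` from ONE equality `rank₂ Cl⁺(L₂) = rank₂ Cl⁺(L₁)` — cubic point field, no other hypothesis** (`W/ℚ` elliptic, `P ∈ W[2] ∖ 0`,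
`[ℚ(P) : ℚ] = 3`; `L₁/ℚ(P)` quadratic with `θ₁² = 2`, `L₂/ℚ(P)` of degree `4` with `θ₂⁴ − 4θ₂² + 2 = 0`): `[Cl⁺(L₂) : Cl⁺(L₂)²] = [Cl⁺(L₁) : Cl⁺(L₁)²]` ⟹ for
every cyclotomic `ℤ₂`-extension `κ` of `ℚ` some `FineSelmerDualData` of `W` has `X` finitely generated over `ℤ₂`.
`NarrowFukuda.narrowMu_of_layerTwo_model_of_finrank_eq_three` + GEN 8's `NarrowMu.conjA_two_of_narrowMu_pointField`.
[cite: Fukuda1994, Thm. 1 (2), p. 264] [cite: Washington1997, §13.1 and Lemma 13.3] [cite: CoatesSujatha2005, Conj. A and Thm. 3.4] -/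
theorem conjA_two_of_narrowRank_layerTwo_eq_pointField {P : geomTorsion W 2} (hP : P ≠ 0)
    (h3 : Module.finrank ℚ ↥(IntermediateField.fixedField (MulAction.stabilizer (absoluteGaloisGroup ℚ) P)) = 3)
    [NumberField ↥(IntermediateField.fixedField (MulAction.stabilizer (absoluteGaloisGroup ℚ) P))]
    (L₁ : Type) [Field L₁] [NumberField L₁] [Algebra ↥(IntermediateField.fixedField (MulAction.stabilizer (absoluteGaloisGroup ℚ) P)) L₁]
    (hL₁ : Module.finrank ↥(IntermediateField.fixedField (MulAction.stabilizer (absoluteGaloisGroup ℚ) P)) L₁ = 2) (θ₁ : L₁) (hθ₁ : θ₁ ^ 2 = 2)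
    (L₂ : Type) [Field L₂] [NumberField L₂] [Algebra ↥(IntermediateField.fixedField (MulAction.stabilizer (absoluteGaloisGroup ℚ) P)) L₂]
    (hL₂ : Module.finrank ↥(IntermediateField.fixedField (MulAction.stabilizer (absoluteGaloisGroup ℚ) P)) L₂ = 4) (θ₂ : L₂)
    (hθ₂ : θ₂ ^ 4 - 4 * θ₂ ^ 2 + 2 = 0)
    (hr : (powMonoidHom (α := NarrowClassGroup L₂) 2).range.index = (powMonoidHom (α := NarrowClassGroup L₁) 2).range.index)
    (κ : ZpExtension ℚ 2) (hκ : κ.IsCyclotomic) :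
    ∃ (γ : absoluteGaloisGroup ℚ) (Dd : W.FineSelmerDualData κ γ),
      Module.Finite ℤ_[2] (RestrictScalars ℤ_[2] (IwasawaAlgebra 2) Dd.X) := by
  obtain ⟨hμ, hδ⟩ := NarrowFukuda.narrowMu_of_layerTwo_model_of_finrank_eq_three
    (↥(IntermediateField.fixedField (MulAction.stabilizer (absoluteGaloisGroup ℚ) P))) h3 L₁ hL₁ θ₁ hθ₁ L₂ hL₂ θ₂ hθ₂ hr
  exact NarrowMu.conjA_two_of_narrowMu_pointField W hP (by rw [h3]; decide) hμ _ hδ κ hκ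

end NoHypothesis

/-- ★ **(A) at `2` for `y² = x³ + px² + qx + r` (irreducible, `β` a root) from ONE equality `rank₂ Cl⁺(ℚ(β,√(2+√2))) = rank₂ Cl⁺(ℚ(β,√2))` — NO OTHER
HYPOTHESIS.**  Models: `L₁ ⊇ ℚ(β)` with `[L₁ : ℚ(β)] = 2`, `θ₁² = 2`; `L₂ ⊇ ℚ(β)` with `[L₂ : ℚ(β)] = 4`, `θ₂⁴ − 4θ₂² + 2 = 0`;
`[Cl⁺(L₂) : Cl⁺(L₂)²] = [Cl⁺(L₁) : Cl⁺(L₁)²]` ⟹ (A)₂ for `⟨0, p, 0, q, r⟩` at every cyclotomic `κ` of `ℚ`.  The cubic field `ℚ(β)` has Fukuda index `≤ 1`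
for every cyclotomic `ℤ₂`-extension (`forall_totallyRamifiedFrom_one_of_finrank_eq_three`), so the rung `n = 1` needs no ramification datum — any
discriminant sign, any behaviour of `2`.  One finite datum per curve: the narrow `2`-ranks of two explicit fields of degrees `6` and `12`.  Nothing is
asserted about any curve. [cite: Fukuda1994, Thm. 1 (2), p. 264] [cite: Washington1997, §13.1 and Lemma 13.3] [cite: CoatesSujatha2005, Conj. A and Thm. 3.4] -/
theorem conjA_two_cubicModel_of_narrowRank_layerTwo_eq (p q r : ℤ)
    [((⟨0, (p : ℚ), 0, (q : ℚ), (r : ℚ)⟩ : WeierstrassCurve ℚ)).IsElliptic]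
    (hirr : Irreducible (Cubic.toPoly ⟨1, (p : ℚ), q, r⟩))
    {β : AlgebraicClosure ℚ} (hβ : aeval β (Cubic.toPoly ⟨1, (p : ℚ), q, r⟩) = 0)
    [NumberField ↥(IntermediateField.adjoin ℚ ({β} : Set (AlgebraicClosure ℚ)))]
    (L₁ : Type) [Field L₁] [NumberField L₁] [Algebra ↥(IntermediateField.adjoin ℚ ({β} : Set (AlgebraicClosure ℚ))) L₁]
    (hL₁ : Module.finrank ↥(IntermediateField.adjoin ℚ ({β} : Set (AlgebraicClosure ℚ))) L₁ = 2) (θ₁ : L₁) (hθ₁ : θ₁ ^ 2 = 2)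
    (L₂ : Type) [Field L₂] [NumberField L₂] [Algebra ↥(IntermediateField.adjoin ℚ ({β} : Set (AlgebraicClosure ℚ))) L₂]
    (hL₂ : Module.finrank ↥(IntermediateField.adjoin ℚ ({β} : Set (AlgebraicClosure ℚ))) L₂ = 4) (θ₂ : L₂)
    (hθ₂ : θ₂ ^ 4 - 4 * θ₂ ^ 2 + 2 = 0)
    (hr : (powMonoidHom (α := NarrowClassGroup L₂) 2).range.index = (powMonoidHom (α := NarrowClassGroup L₁) 2).range.index)
    (κ : ZpExtension ℚ 2) (hκ : κ.IsCyclotomic) :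
    ∃ (γ : absoluteGaloisGroup ℚ) (Dd : ((⟨0, (p : ℚ), 0, (q : ℚ), (r : ℚ)⟩ : WeierstrassCurve ℚ)).FineSelmerDualData κ γ),
      Module.Finite ℤ_[2] (RestrictScalars ℤ_[2] (IwasawaAlgebra 2) Dd.X) := by
  have hmonic : (Cubic.toPoly ⟨1, (p : ℚ), q, r⟩).Monic := Cubic.monic_of_a_eq_one rfl
  have hβint : IsIntegral ℚ β := ⟨_, hmonic, by rwa [← aeval_def]⟩
  have h3 : Module.finrank ℚ ↥(IntermediateField.adjoin ℚ ({β} : Set (AlgebraicClosure ℚ))) = 3 := by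
    rw [IntermediateField.adjoin.finrank hβint, ← minpoly.eq_of_irreducible_of_monic hirr hβ hmonic]
    exact Cubic.natDegree_of_a_ne_zero' one_ne_zero
  obtain ⟨hμ, hδ⟩ := NarrowFukuda.narrowMu_of_layerTwo_model_of_finrank_eq_three
    (↥(IntermediateField.adjoin ℚ ({β} : Set (AlgebraicClosure ℚ)))) h3 L₁ hL₁ θ₁ hθ₁ L₂ hL₂ θ₂ hθ₂ hr
  exact NarrowMu.conjA_two_cubicModel_of_narrowMu p q r hirr hβ hμ _ hδ κ hκ

/-- Transport of the narrow `q`-rank of a layer along unit twists: two cyclotomic `ℤ₂`-extensions of the same field have the same layers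
(`ZpExtension.layer_unitTwist`), hence the same `[Cl⁺(F_m) : Cl⁺(F_m)^q]` for any `NumberField` instances on them.
[cite: Washington1997, §13.1 (`K_∞` and its layers do not depend on the choice of `κ`)] -/
theorem index_layer_eq_of_isCyclotomic {F : Type} [Field F] [NumberField F] (κ₁ κ₂ : ZpExtension F 2)
    (h₁ : κ₁.IsCyclotomic) (h₂ : κ₂.IsCyclotomic) (m q : ℕ) [NumberField ↥(κ₁.layer m)] [NumberField ↥(κ₂.layer m)] :
    (powMonoidHom (α := NarrowClassGroup ↥(κ₂.layer m)) q).range.index = (powMonoidHom (α := NarrowClassGroup ↥(κ₁.layer m)) q).range.index := by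
  haveI : Fact (Nat.Prime 2) := ⟨Nat.prime_two⟩
  obtain ⟨u, hu⟩ := ZpExtension.IsCyclotomic.exists_eq_unitTwist_holds h₁ h₂
  have hlayer : κ₂.layer m = κ₁.layer m := by rw [hu]; exact ZpExtension.layer_unitTwist κ₁ u m
  exact index_range_pow_narrowClassGroup_eq_of_ringEquiv (IntermediateField.equivOfEq hlayer).toRingEquiv q

/-- **The narrow rank certificate `(n₀, B) = (1, B)` of a CUBIC field from the ONE equality `rank₂ Cl⁺(F_2) = rank₂ Cl⁺(F_1)`** (abstract layers, every
cyclotomic `ℤ₂`-extension): Fukuda's index is `≤ 1` unconditionally (`forall_totallyRamifiedFrom_one_of_finrank_eq_three`), and a bound `B` for the narrow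
`2`-ranks of the layers `0, 1` exists uniformly in `κ` (the layers of two cyclotomic `κ` agree, `index_layer_eq_of_isCyclotomic`).  Output = the hypothesis
`hcert` of GEN 9's `NarrowFukuda.narrowMu_of_narrowRankCertificate` / `conjA_two_of_narrowRankCertificate_pointField` with `n₀ = 1`.
[cite: Fukuda1994, Thm. 1 (2), p. 264] [cite: Washington1997, §13.1 and Lemma 13.3] -/
theorem exists_narrowRankCertificate_one_of_finrank_eq_three {F : Type} [Field F] [NumberField F] (h3 : Module.finrank ℚ F = 3)
    (hcert : ∀ κP : ZpExtension F 2, κP.IsCyclotomic → ∀ [NumberField ↥(κP.layer 1)] [NumberField ↥(κP.layer 2)],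
      (powMonoidHom (α := NarrowClassGroup ↥(κP.layer 2)) 2).range.index = (powMonoidHom (α := NarrowClassGroup ↥(κP.layer 1)) 2).range.index) :
    ∃ B : ℕ, ∀ κP : ZpExtension F 2, κP.IsCyclotomic →
      TotallyRamifiedFrom κP 1 ∧
      (∀ [NumberField ↥(κP.layer 1)] [NumberField ↥(κP.layer (1 + 1))],
        (powMonoidHom (α := NarrowClassGroup ↥(κP.layer (1 + 1))) 2).range.index =
          (powMonoidHom (α := NarrowClassGroup ↥(κP.layer 1)) 2).range.index) ∧
      (∀ m : ℕ, m ≤ 1 → ∀ [NumberField ↥(κP.layer m)],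
        padicValNat 2 (powMonoidHom (α := NarrowClassGroup ↥(κP.layer m)) 2).range.index ≤ B) := by
  haveI : Fact (Nat.Prime 2) := ⟨Nat.prime_two⟩
  have hK : ¬ 2 ∣ Module.finrank ℚ F := by rw [h3]; decide
  -- a fixed cyclotomic `ℤ₂`-extension `κ₀` of `F` and the bound `B`
  have hsurj := ZpExtension.surjective_comp_absGaloisRestrict_of_not_dvd_finrank (CyclotomicZp.zpExtension 2) F hK
  have hκ₀ : ((CyclotomicZp.zpExtension 2).restrict F hsurj).IsCyclotomic :=
    ZpExtension.isCyclotomic_restrict _ (CyclotomicZp.isCyclotomic_zpExtension 2) F hsurj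
  haveI : FiniteDimensional F ↥(((CyclotomicZp.zpExtension 2).restrict F hsurj).layer 1) :=
    ((CyclotomicZp.zpExtension 2).restrict F hsurj).finiteDimensional_layer_holds 1
  haveI : NumberField ↥(((CyclotomicZp.zpExtension 2).restrict F hsurj).layer 1) := NumberField.of_module_finite F _
  refine ⟨max (padicValNat 2 (powMonoidHom (α := NarrowClassGroup F) 2).range.index)
    (padicValNat 2 (powMonoidHom (α := NarrowClassGroup ↥(((CyclotomicZp.zpExtension 2).restrict F hsurj).layer 1)) 2).range.index),
    fun κP hκP => ⟨forall_totallyRamifiedFrom_one_of_finrank_eq_three h3 κP hκP, ?_, ?_⟩⟩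
  · intro i1 i2
    exact @hcert κP hκP i1 i2
  · intro m hm _
    rcases Nat.le_one_iff_eq_zero_or_eq_one.mp hm with rfl | rfl
    · rw [index_range_pow_narrowClassGroup_layer_zero_eq κP 2]
      exact le_max_left _ _
    · rw [index_layer_eq_of_isCyclotomic ((CyclotomicZp.zpExtension 2).restrict F hsurj) κP hκ₀ hκP 1 2]
      exact le_max_right _ _

/-- ★ **THE Q⁺ ROAD AT THE RUNG `n = 1`: `FineSelmerConjATwoOrdPosDisc` FROM ONE EQUALITY OF NARROW `2`-RANKS PER CURVE — KERNEL, NO OTHER DATUM.**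
If at every curve of the cell [non-CM, analytic rank `0`, good ordinary at `2`, `ρ̄_{W,2}` onto, `0 < Δ`] SOME non-zero `P ∈ W[2]` has
`rank₂ Cl⁺(ℚ(P)_2) = rank₂ Cl⁺(ℚ(P)_1)` — equal indices `[Cl⁺ : (Cl⁺)²]` at the layers `1` and `2` of every cyclotomic `ℤ₂`-extension of the totally real
cubic `ℚ(P) = ℚ̄^{Stab P}` (for any `NumberField` instances on the layers; concretely the narrow `2`-ranks of `ℚ(P)(√2)` and `ℚ(P)(√(2+√2))`, degrees
`6` and `12`) — then `FineSelmerConjATwoOrdPosDisc` (the (A)₂-half of G11⁺ = Greenberg's Conj. 1.11 at `2` on the cell).  GEN 9's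
`conjA_two_of_narrowRankCertificate_pointField` with the certificate data DISCHARGED (`exists_narrowRankCertificate_one_of_finrank_eq_three`; `[ℚ(P):ℚ] = 3` as
`ρ̄₂` is irreducible).  Prices Q⁺ as ONE class-group equality per curve (Greenberg-conjecture territory for the cubic; nothing is asserted about any curve).
[cite: Fukuda1994, Thm. 1 (2), p. 264] [cite: Washington1997, §13.1 and Lemma 13.3] [cite: CoatesSujatha2005, Conj. A] [cite: GreenbergLNM1716, Conj. 1.11 and p. 122] -/
theorem fineSelmerConjATwoOrdPosDisc_of_narrowRank_layer_two_eq_layer_one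
    (hIw : ∀ (W : WeierstrassCurve ℚ) [W.IsElliptic] [W.IsGloballyMinimal], ¬ W.HasCM → W.analyticRank = 0 →
      GoodOrd W 2 → W.HasSurjectiveModNGaloisRep 2 → 0 < W.Δ →
      ∃ P : geomTorsion W 2, P ≠ 0 ∧
        ∀ κP : ZpExtension ↥(IntermediateField.fixedField (MulAction.stabilizer (absoluteGaloisGroup ℚ) P)) 2,
          κP.IsCyclotomic → ∀ [NumberField ↥(κP.layer 1)] [NumberField ↥(κP.layer 2)],
            (powMonoidHom (α := NarrowClassGroup ↥(κP.layer 2)) 2).range.index =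
              (powMonoidHom (α := NarrowClassGroup ↥(κP.layer 1)) 2).range.index) :
    FineSelmerConjATwoOrdPosDisc := by
  intro W _ _ hcm hr hgo h2 hΔ κ hκ
  obtain ⟨P, hP, hcert⟩ := hIw W hcm hr hgo h2 hΔ
  have h3 : Module.finrank ℚ ↥(IntermediateField.fixedField (MulAction.stabilizer (absoluteGaloisGroup ℚ) P)) = 3 :=
    finrank_fixedField_stabilizer_eq_three_of_irreducible W (hasIrreducibleModPGaloisRep_of_hasSurjectiveModNGaloisRep W 2 h2) hP
  haveI : FiniteDimensional ℚ ↥(IntermediateField.fixedField (MulAction.stabilizer (absoluteGaloisGroup ℚ) P)) :=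
    finiteDimensional_fixedField_stabilizer W P
  haveI : NumberField ↥(IntermediateField.fixedField (MulAction.stabilizer (absoluteGaloisGroup ℚ) P)) :=
    NumberField.of_module_finite ℚ _
  obtain ⟨B, hB⟩ := exists_narrowRankCertificate_one_of_finrank_eq_three h3 hcert
  exact conjA_two_of_narrowRankCertificate_pointField W hP (by rw [h3]; decide) 1 B hB κ hκ

end Summit.BirchSwinnertonDyer.BirchSwinnertonDyer.Theorems.SteinbergFibreAtTwo.NarrowRankCert

end
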